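import Mathlib
import Literature.Analysis.FluidPDE.KNSSAxisymmetricNoSwirlHolds
import Literature.Analysis.FluidPDE.KNSSPoloidalAxisDecay
import Literature.Analysis.FluidPDE.LeiZhangZhao2017LiouvilleSwirlLp
import Literature.Analysis.FluidPDE.SelfSimilarLiouvilleSwirlDecayProofs
import Literature.Analysis.FluidPDE.SelfSimilarLiouvilleSwirlSupProofs
import Literature.Analysis.FluidPDE.LeiRenZhang2019Liouville
import Literature.Analysis.FluidPDE.LeiRenZhang2019PeriodicLiouville
import Summits.NavierStokesRegularity.OSWSelfSimilar.TypeIIInnerLimitOfSingularity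
import HarnessLib
/-!
# What a type-(β) inner object must violate, BY DECL (zone Z1 TEMPLATE §T1.4 (I-5), kernel)

HONEST FRAMING (cell ns-blowup GROUP B «PROFILE SEARCH», zone Z1; D-0035/D-0074): part XXIV of the Z1 dictionary. TEMPLATE
§T1.4 (I-5) lists, for a type-(β) inner object `W` of the Z1 ansatz (a KNSS blow-up limit — smooth bounded ancient mild
solution, `|W| ≤ 1 = sup|W|` — which is axisymmetric with bounded swirl on every slice and has ONE non-constant slice), the
partial Liouville theorems it must VIOLATE and the structural facts it must SATISFY, «all … DISCHARGED in the tree, so each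
hypothesis below is a theorem-grade kill». Until now the census carried these only as the list «consistent-with (discharged)
`knss_axisymmetric_no_swirl_holds`, `knss_bound_C_over_r_holds`, `leiZhangZhao2017_liouville_swirl_Lp_holds`,
`…_swirl_decay_holds`, `leiRenZhang2019_swirl_sup_at_infinity_holds`, `leiRenZhang2019_liouville_swirl_rate_holds`»; no
declaration composed them with the inner-object class `Literature.Analysis.FluidPDE.IsKNSSBlowupLimit`. This file does:

* `knssBlowupLimit_apply_eq_of_ae_eq_const`, `knssBlowupLimit_not_ae_axial_of_typeBeta` — bookkeeping: a slice of a
  KNSS blow-up limit which is a.e. a constant IS that constant (smooth slices); a type-(β) object is not slice-wise a.e.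
  an axial constant;
* (I-5)(i) `typeBeta_exists_swirl_ne_zero` — **swirl present** on some slice (else KNSS Thm 5.2 ⇒ constant), and its
  positive-measure form `typeBeta_measure_swirl_ne_zero_pos`;
* (I-5)(ii) `knssBlowupLimit_exists_slice_not_ae_zero`, `knssBlowupLimit_VCR`, `knssBlowupLimit_VCR_poloidal` —
  **`violates: V-CR`**: `r‖W‖` and `r‖W_pol‖` are unbounded on `(−∞,0) × ℝ³` (KNSS Thm 5.3 in the tree's poloidal form
  `exists_poloidal_axisDecay_gt_of_ancient_nontrivial`) — this one holds for EVERY axisymmetric inner object with bounded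
  swirl, type (α) included, because `sup|W| = 1` forbids `W ≡ 0`;
* (I-5)(iii) `typeBeta_eLpNorm_swirl_unbounded` — **`Γ ∉ L^∞_s L^p_y` for every `1 ≤ p < ∞`** (Lei–Zhang–Zhao 2017 Thm 1.3);
* (I-5)(iv) `typeBeta_swirl_not_decay` — **`Γ(s, ·)` does NOT tend to `0` at radial infinity uniformly in `(z, s)`**
  (Lei–Zhang–Zhao Rem. 1.4);
* (I-5)(v) `knssBlowupLimit_swirl_sup_at_infinity` — **the swirl supremum is approached AT RADIAL INFINITY**, in the
  plain `sup` form for the continuous representative (Lei–Ren–Zhang 2019 §4; holds for every axisymmetric inner object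
  with bounded swirl);
* (I-5)(vi) `typeBeta_not_swirl_rate` — **NOT at the LRZ rate**: with the absolute constant `ε₀ = ε₀(1) ∈ (0,1)` of
  Lei–Ren–Zhang Thm 1.2 at the bound `‖W‖ ≤ 1`, for no `L`, `R₀` does `|Γ² − L²| ≤ ε₀L²/r` hold on `r ≥ R₀`;
* (I-5)(vii) `typeBeta_not_periodic` — **not `z`-periodic**, CONDITIONAL on the NAMED fact
  `leiRenZhang2019_liouville_periodic` (LRZ Thm 1.1 = Math. Ann. 383 (2022); not discharged in the tree);
* (I-4)(α) in Case A: `apply_eq_smul_eZ_of_isAxisymmetric_of_const`, `knssBlowupLimit_axialStream_of_const` — an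
  axisymmetric constant slice is AXIAL (`W(s, ·) ≡ β(s) e_z`, `|β| ≤ 1`, `sup|β| = 1`).

**Nothing here asserts that a type-(β) inner object, a blow-up, or an (AX-L) counterexample exists; every theorem is an
implication on a hypothetical object.** «violates: n/a — dictionary; it TYPES the `violates:` list of TEMPLATE (I-5)»;
bears_on LADDER-NS N5/Z1 → N1 linear core / N0⁻ ((I-4)/(I-5)). Author: ns-blowup-profile-eng-1 g8, 2026-08-27.
-/

open Real Filter Topology Set MeasureTheory Function
open scoped ENNReal NNReal
open Literature.Analysis.FluidPDE

namespace Summit.NavierStokesRegularity.OSWSelfSimilar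
namespace TypeIIModulationDictionary

section TypeBeta

variable {W : ℝ → EuclideanSpace ℝ (Fin 3) → EuclideanSpace ℝ (Fin 3)}

/-- **A slice of a KNSS blow-up limit which is a.e. a constant IS that constant** (the slices are smooth, in particular
continuous; Lebesgue measure charges open sets). The bridge from the a.e. conclusions of the Liouville theorems of the
duality-form class to pointwise statements on the inner object. [new here — bookkeeping] -/
theorem knssBlowupLimit_apply_eq_of_ae_eq_const (hW : IsKNSSBlowupLimit W) {s : ℝ} (hs : s < 0)
    {b : EuclideanSpace ℝ (Fin 3)} (hb : W s =ᵐ[volume] fun _ => b) (x : EuclideanSpace ℝ (Fin 3)) :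
    W s x = b := by
  have hc : Continuous (W s) := continuous_slice_of_continuousOn_Iio hW.smooth.continuousOn hs
  exact congr_fun (Measure.eq_of_ae_eq hb hc continuous_const) x

/-- **A type-(β) inner object is not slice-wise a.e. an axial constant**: if one slice `W(s, ·)` is non-constant, the
common conclusion shape `∀ s < 0, ∃ β, W s =ᵐ β • e_z` of KNSS Thm 5.2 / LZZ 2017 / LRZ 2019 fails. [new here —
bookkeeping] -/
theorem knssBlowupLimit_not_ae_axial_of_typeBeta (hW : IsKNSSBlowupLimit W)
    (hnc : ∃ s < 0, ∃ x : EuclideanSpace ℝ (Fin 3), W s x ≠ W s 0) :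
    ¬ ∀ s < 0, ∃ β : ℝ, W s =ᵐ[volume] fun _ => β • eZ := by
  intro h
  obtain ⟨s, hs, x, hx⟩ := hnc
  obtain ⟨β, hβ⟩ := h s hs
  exact hx (by rw [knssBlowupLimit_apply_eq_of_ae_eq_const hW hs hβ x,
    knssBlowupLimit_apply_eq_of_ae_eq_const hW hs hβ 0])

/-- The swirl of a slice of a KNSS blow-up limit is continuous (`Γ = x₀u₁ − x₁u₀`, continuous slice).
[new here — elementary] -/
theorem continuous_swirl_slice (hW : IsKNSSBlowupLimit W) {s : ℝ} (hs : s < 0) : Continuous (swirl (W s)) :=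
  (contDiff_swirl (contDiff_zero.2 (continuous_slice_of_continuousOn_Iio hW.smooth.continuousOn hs))).continuous

/-- **TEMPLATE (I-5)(i): a type-(β) inner object carries swirl.** A KNSS blow-up limit with axisymmetric slices and one
non-constant slice has `Γ_W(s, x) ≠ 0` for some `s < 0`, `x` — else the tree's DISCHARGED KNSS 2009 Thm 5.2
`knss_axisymmetric_no_swirl_holds` makes every slice a.e. `β(s) e_z`, hence (smoothness) constant. No swirl BOUND is
needed for this item. [new here — dictionary; composes `knss_axisymmetric_no_swirl_holds`] -/
theorem typeBeta_exists_swirl_ne_zero (hW : IsKNSSBlowupLimit W) (hax : ∀ s < 0, IsAxisymmetric (W s))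
    (hnc : ∃ s < 0, ∃ x : EuclideanSpace ℝ (Fin 3), W s x ≠ W s 0) :
    ∃ s < 0, ∃ x : EuclideanSpace ℝ (Fin 3), swirl (W s) x ≠ 0 := by
  by_contra h
  push Not at h
  exact knssBlowupLimit_not_ae_axial_of_typeBeta hW hnc
    (knss_axisymmetric_no_swirl_holds hW.isBoundedAncientMildSolution hW.aestronglyMeasurable hax
      (fun s hs x => h s hs x))

/-- (I-5)(i), positive-measure form (the shape consumed by `leiRenZhang2019_liouville_periodic.not_periodic_of_swirl_ne_zero`
and by the `L^p` items): some slice has `{x | Γ_W(s, x) ≠ 0}` of positive Lebesgue measure (an open non-empty set).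
[new here — dictionary] -/
theorem typeBeta_measure_swirl_ne_zero_pos (hW : IsKNSSBlowupLimit W) (hax : ∀ s < 0, IsAxisymmetric (W s))
    (hnc : ∃ s < 0, ∃ x : EuclideanSpace ℝ (Fin 3), W s x ≠ W s 0) :
    ∃ s < 0, 0 < volume {x : EuclideanSpace ℝ (Fin 3) | swirl (W s) x ≠ 0} := by
  obtain ⟨s, hs, x, hx⟩ := typeBeta_exists_swirl_ne_zero hW hax hnc
  have hopen : IsOpen {x : EuclideanSpace ℝ (Fin 3) | swirl (W s) x ≠ 0} :=
    isOpen_ne_fun (continuous_swirl_slice hW hs) continuous_const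
  exact ⟨s, hs, hopen.measure_pos volume ⟨x, hx⟩⟩

/-- **Every KNSS blow-up limit has a slice which is not a.e. zero** (`sup|W| = 1`: some value exceeds `0` in norm, and the
slice is continuous). [new here — bookkeeping] -/
theorem knssBlowupLimit_exists_slice_not_ae_zero (hW : IsKNSSBlowupLimit W) : ∃ s < 0, ¬ (W s =ᵐ[volume] 0) := by
  obtain ⟨s, hs, x, hx⟩ := hW.exists_lt_norm 1 one_pos
  refine ⟨s, hs, fun h0 => ?_⟩
  have h := knssBlowupLimit_apply_eq_of_ae_eq_const hW hs (b := 0) h0 x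
  rw [h, norm_zero] at hx
  linarith

/-- **TEMPLATE (I-5)(ii) `violates: V-CR`: `r‖W‖` is unbounded.** For EVERY KNSS blow-up limit with axisymmetric slices
(type (α) or (β) alike) and every `C` there are `s < 0`, `x` with `C < r(x)‖W(s, x)‖` — else the tree's DISCHARGED KNSS
2009 Thm 5.3 `knss_bound_C_over_r_holds` forces `W ≡ 0` a.e. on every slice, impossible for `sup|W| = 1`. (K8's second
alternative read on the inner object; TEMPLATE (N4′)/(I-5 ii).) [new here — dictionary; composes `knss_bound_C_over_r_holds`] -/
theorem knssBlowupLimit_VCR (hW : IsKNSSBlowupLimit W) (hax : ∀ s < 0, IsAxisymmetric (W s)) (C : ℝ) :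
    ∃ s < 0, ∃ x : EuclideanSpace ℝ (Fin 3), C < cylRadius x * ‖W s x‖ := by
  by_contra h
  push Not at h
  obtain ⟨s, hs, hne⟩ := knssBlowupLimit_exists_slice_not_ae_zero hW
  exact hne (knss_bound_C_over_r_holds hW.isBoundedAncientMildSolution hW.aestronglyMeasurable hax ⟨C, h⟩ s hs)

/-- **(I-5)(ii), poloidal form: «the violation sits in the poloidal far field».** For every KNSS blow-up limit with
axisymmetric slices and BOUNDED swirl, `r‖(W^r, W^z)‖` is unbounded: for every `C` some `s < 0`, `x` have
`C < r(x)‖W_pol(s, x)‖` (the tree's `exists_poloidal_axisDecay_gt_of_ancient_nontrivial`: `|W^θ| ≤ ‖Γ‖_∞/r` is automatic,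
so KNSS 5.3 bites on the poloidal part). [new here — dictionary; composes `exists_poloidal_axisDecay_gt_of_ancient_nontrivial`] -/
theorem knssBlowupLimit_VCR_poloidal (hW : IsKNSSBlowupLimit W) (hax : ∀ s < 0, IsAxisymmetric (W s))
    (hsw : ∃ C : ℝ, ∀ s < 0, ∀ x, |swirl (W s) x| ≤ C) (C : ℝ) :
    ∃ s < 0, ∃ x : EuclideanSpace ℝ (Fin 3), C < cylRadius x * ‖poloidalPart (W s) x‖ :=
  exists_poloidal_axisDecay_gt_of_ancient_nontrivial hW.isBoundedAncientMildSolution hW.aestronglyMeasurable hax hsw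
    (knssBlowupLimit_exists_slice_not_ae_zero hW) C

/-- **TEMPLATE (I-5)(iii): `Γ_W ∉ L^∞_s L^p_y` for every `1 ≤ p < ∞`.** For a type-(β) inner object (KNSS blow-up limit,
axisymmetric slices, one non-constant slice) and every `1 ≤ p < ∞`, `K`, some slice has `‖Γ_W(s, ·)‖_{L^p} > K` — else
the tree's DISCHARGED Lei–Zhang–Zhao 2017 Thm 1.3 `leiZhangZhao2017_liouville_swirl_Lp_holds` makes every slice a.e. an
axial constant. [new here — dictionary; composes `leiZhangZhao2017_liouville_swirl_Lp_holds`] -/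
theorem typeBeta_eLpNorm_swirl_unbounded (hW : IsKNSSBlowupLimit W) (hax : ∀ s < 0, IsAxisymmetric (W s))
    (hnc : ∃ s < 0, ∃ x : EuclideanSpace ℝ (Fin 3), W s x ≠ W s 0) {p : ℝ≥0∞} (hp1 : 1 ≤ p) (hp : p < ⊤)
    (K : ℝ≥0) : ∃ s < 0, (K : ℝ≥0∞) < eLpNorm (swirl (W s)) p volume := by
  by_contra h
  push Not at h
  exact knssBlowupLimit_not_ae_axial_of_typeBeta hW hnc
    (leiZhangZhao2017_liouville_swirl_Lp_holds W hW.isBoundedAncientMildSolution hW.aestronglyMeasurable hax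
      ⟨p, K, hp1, hp, h⟩)

/-- **TEMPLATE (I-5)(iv): the swirl does NOT decay at radial infinity uniformly in `(z, s)`.** For a type-(β) inner object
there is `ε > 0` such that for every `R` some `s < 0`, `x` with `r(x) ≥ R` have `|Γ_W(s, x)| > ε` — else the tree's
DISCHARGED Lei–Zhang–Zhao 2017 Rem. 1.4 `leiZhangZhao2017_liouville_swirl_decay_holds` makes every slice a.e. an axial
constant. [new here — dictionary; composes `leiZhangZhao2017_liouville_swirl_decay_holds`] -/
theorem typeBeta_swirl_not_decay (hW : IsKNSSBlowupLimit W) (hax : ∀ s < 0, IsAxisymmetric (W s))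
    (hnc : ∃ s < 0, ∃ x : EuclideanSpace ℝ (Fin 3), W s x ≠ W s 0) :
    ∃ ε : ℝ, 0 < ε ∧ ∀ R : ℝ, ∃ s < 0, ∃ x : EuclideanSpace ℝ (Fin 3), R ≤ cylRadius x ∧ ε < |swirl (W s) x| := by
  by_contra h
  push Not at h
  exact knssBlowupLimit_not_ae_axial_of_typeBeta hW hnc
    (leiZhangZhao2017_liouville_swirl_decay_holds W hW.isBoundedAncientMildSolution hW.aestronglyMeasurable hax h)

/-- **TEMPLATE (I-5)(v): the swirl supremum is approached AT RADIAL INFINITY** (Lei–Ren–Zhang 2019 §4, tree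
`leiRenZhang2019_swirl_sup_at_infinity_holds`, DISCHARGED), in the plain `sup` form for the continuous representative: for
every KNSS blow-up limit with axisymmetric slices and bounded swirl, every level `ℓ` exceeded by `|Γ_W|` somewhere is
exceeded beyond every radius `R` as well (some `s < 0`, `x` with `r(x) ≥ R`, `|Γ_W(s, x)| > ℓ`) — so `W` carries its
circulation «at infinity» while `Γ_W = 0` on the axis. Superlevel sets of the continuous `|Γ_W(s, ·)|` are open, hence of
positive measure iff non-empty. [new here — dictionary; composes `leiRenZhang2019_swirl_sup_at_infinity_holds`] -/
theorem knssBlowupLimit_swirl_sup_at_infinity (hW : IsKNSSBlowupLimit W) (hax : ∀ s < 0, IsAxisymmetric (W s))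
    (hsw : ∃ C : ℝ, ∀ s < 0, ∀ x, |swirl (W s) x| ≤ C) {ℓ : ℝ} (R : ℝ)
    (hℓ : ∃ s₀ < 0, ∃ x₀ : EuclideanSpace ℝ (Fin 3), ℓ < |swirl (W s₀) x₀|) :
    ∃ s < 0, ∃ x : EuclideanSpace ℝ (Fin 3), R ≤ cylRadius x ∧ ℓ < |swirl (W s) x| := by
  obtain ⟨s₀, hs₀, x₀, hx₀⟩ := hℓ
  have hopen : IsOpen {x : EuclideanSpace ℝ (Fin 3) | ℓ < |swirl (W s₀) x|} :=
    isOpen_lt continuous_const (continuous_swirl_slice hW hs₀).abs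
  have hpos : 0 < volume {x : EuclideanSpace ℝ (Fin 3) | ℓ < |swirl (W s₀) x|} := hopen.measure_pos volume ⟨x₀, hx₀⟩
  obtain ⟨s, hs, hvol⟩ := leiRenZhang2019_swirl_sup_at_infinity_holds W hW.isBoundedAncientMildSolution
    hW.aestronglyMeasurable hax hsw ℓ R ⟨s₀, hs₀, hpos⟩
  obtain ⟨x, hx⟩ := nonempty_of_measure_ne_zero hvol.ne'
  exact ⟨s, hs, x, hx⟩

/-- **TEMPLATE (I-5)(vi): NOT at the Lei–Ren–Zhang rate.** There is an absolute `ε₀ ∈ (0, 1)` (the constant of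
Lei–Ren–Zhang 2019 Thm 1.2 at the velocity bound `M = 1`, which every KNSS blow-up limit obeys) such that for every
type-(β) inner object `W` (axisymmetric slices, bounded swirl, one non-constant slice) and all `L`, `R₀` some `s < 0`, `x`
with `r(x) ≥ R₀` have `|Γ_W(s, x)² − L²| > ε₀ L² / r(x)` — else the tree's DISCHARGED
`leiRenZhang2019_liouville_swirl_rate_holds` makes every slice a.e. an axial constant. [new here — dictionary; composes
`leiRenZhang2019_liouville_swirl_rate_holds`] -/
theorem typeBeta_not_swirl_rate :
    ∃ ε₀ ∈ Set.Ioo (0 : ℝ) 1, ∀ W : ℝ → EuclideanSpace ℝ (Fin 3) → EuclideanSpace ℝ (Fin 3), IsKNSSBlowupLimit W →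
      (∀ s < 0, IsAxisymmetric (W s)) → (∃ C : ℝ, ∀ s < 0, ∀ x, |swirl (W s) x| ≤ C) →
        (∃ s < 0, ∃ x : EuclideanSpace ℝ (Fin 3), W s x ≠ W s 0) →
          ∀ L R₀ : ℝ, ∃ s < 0, ∃ x : EuclideanSpace ℝ (Fin 3),
            R₀ ≤ cylRadius x ∧ ε₀ * L ^ 2 / cylRadius x < |swirl (W s) x ^ 2 - L ^ 2| := by
  obtain ⟨ε₀, hε₀, h⟩ := leiRenZhang2019_liouville_swirl_rate_holds 1
  refine ⟨ε₀, hε₀, fun W hW hax hsw hnc L R₀ => ?_⟩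
  by_contra hcon
  push Not at hcon
  exact knssBlowupLimit_not_ae_axial_of_typeBeta hW hnc
    (h W hW.isBoundedAncientMildSolution hW.norm_le_one hW.aestronglyMeasurable hax hsw ⟨L, R₀, hcon⟩)

/-- **TEMPLATE (I-5)(vii): NOT `z`-periodic — CONDITIONAL on the NAMED fact `leiRenZhang2019_liouville_periodic`**
(Lei–Ren–Zhang 2019 Thm 1.1 = Math. Ann. 383 (2022): bounded ancient mild axisymmetric, `Γ` bounded, `z`-periodic ⇒
`c e_z`; NOT discharged in the tree — this theorem is conditional on it). A type-(β) inner object with bounded swirl is not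
periodic in `z` with any period: it carries swirl on an open set of some slice ((i)), which the fact's kill form
`not_periodic_of_swirl_ne_zero` forbids. Relevant to TEMPLATE T1.5 (`z`-periodic pipe data: the rescaled period
`L_z/λ → ∞`). [new here — dictionary; CONDITIONAL on `leiRenZhang2019_liouville_periodic`] -/
theorem typeBeta_not_periodic (hLRZ : leiRenZhang2019_liouville_periodic) (hW : IsKNSSBlowupLimit W)
    (hax : ∀ s < 0, IsAxisymmetric (W s)) (hsw : ∃ C : ℝ, ∀ s < 0, ∀ x, |swirl (W s) x| ≤ C)
    (hnc : ∃ s < 0, ∃ x : EuclideanSpace ℝ (Fin 3), W s x ≠ W s 0) :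
    ¬ ∃ P : ℝ, 0 < P ∧ ∀ s < 0, Function.Periodic (W s) (P • eZ) := by
  obtain ⟨s, hs, hpos⟩ := typeBeta_measure_swirl_ne_zero_pos hW hax hnc
  exact hLRZ.not_periodic_of_swirl_ne_zero hW.isBoundedAncientMildSolution hW.aestronglyMeasurable hax hsw hs hpos

/-- **TEMPLATE (I-4)(α), Case A: «an axisymmetric constant is axial».** If a slice `V` is axisymmetric and constant, then
its value is `β e_z` with `β = V(0)₂` (the rotation `R_π` fixes `V 0` and negates its horizontal components). So a
type-(α) Case-A inner object is an axial stream `W(s, ·) ≡ β(s) e_z`. [new here — elementary] -/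
theorem apply_eq_smul_eZ_of_isAxisymmetric_of_const {V : EuclideanSpace ℝ (Fin 3) → EuclideanSpace ℝ (Fin 3)}
    (hax : IsAxisymmetric V) (hc : ∀ y, V y = V 0) : V 0 = (V 0 2) • eZ := by
  have hfix : rotZ Real.pi (V 0) = V 0 := by rw [← hax Real.pi 0, hc]
  have h0 : V 0 0 = 0 := by
    have h := congr_arg (fun z : EuclideanSpace ℝ (Fin 3) => z 0) hfix
    simp only [rotZ_apply_zero, Real.cos_pi, Real.sin_pi] at h
    linarith
  have h1 : V 0 1 = 0 := by
    have h := congr_arg (fun z : EuclideanSpace ℝ (Fin 3) => z 1) hfix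
    simp only [rotZ_apply_one, Real.cos_pi, Real.sin_pi] at h
    linarith
  ext i
  fin_cases i <;> simp [eZ, h0, h1]

/-- **The type-(α) Case-A inner object is an axial stream with `|β(s)| ≤ 1` and `sup|β| = 1`.** For a KNSS blow-up limit
with axisymmetric slices which is constant in space on every slice: `W(s, y) = β(s) e_z` with `β(s) = W(s, 0)₂`,
`|β(s)| ≤ 1` for all `s < 0`, and `|β(s)| > 1 − ε` for some `s < 0`, every `ε > 0` (TEMPLATE (I-4)(α): «the velocity
maximum sits in an increasingly uniform axial stream»). [new here — dictionary] -/
theorem knssBlowupLimit_axialStream_of_const (hW : IsKNSSBlowupLimit W) (hax : ∀ s < 0, IsAxisymmetric (W s))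
    (hconst : ∀ s < 0, ∀ y : EuclideanSpace ℝ (Fin 3), W s y = W s 0) :
    (∀ s < 0, ∀ y : EuclideanSpace ℝ (Fin 3), W s y = (W s 0 2) • eZ) ∧ (∀ s < 0, |W s 0 2| ≤ 1) ∧
      ∀ ε : ℝ, 0 < ε → ∃ s < 0, 1 - ε < |W s 0 2| := by
  have hnorm : ∀ s < 0, ‖W s 0‖ = |W s 0 2| := by
    intro s hs
    rw [apply_eq_smul_eZ_of_isAxisymmetric_of_const (hax s hs) (hconst s hs), norm_smul, Real.norm_eq_abs]
    simp [eZ]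
  refine ⟨fun s hs y => ?_, fun s hs => ?_, fun ε hε => ?_⟩
  · rw [hconst s hs y]
    exact apply_eq_smul_eZ_of_isAxisymmetric_of_const (hax s hs) (hconst s hs)
  · rw [← hnorm s hs]; exact hW.norm_le_one s hs 0
  · obtain ⟨s, hs, x, hx⟩ := hW.exists_lt_norm ε hε
    exact ⟨s, hs, by rwa [hconst s hs x, hnorm s hs] at hx⟩

end TypeBeta

end TypeIIModulationDictionary
end Summit.NavierStokesRegularity.OSWSelfSimilar
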